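import Summits.QuantumFields.BalabanUV.Beta.FP.PolarizationGermPker
import Summits.QuantumFields.BalabanUV.Beta.FP.PerfectPropagatorLegDataFree
import Summits.QuantumFields.BalabanUV.Beta.FP.BlockAveragedKernelLegs

/-!
# `BalabanUV.Beta.FP.PolarizationGermGhost` — road «FP» for binder row D1, leaf (H2), row **H2-ASM-5** (owner END), module B:
# THE GHOST-SECTOR END OF H2-ASM-3 AT THE EXPLICIT GHOST LEG `G0ker = latticeGreen∕2` — the tree's free-leg letters (Lawler–Limic asymptotics packaged
# by `TwoPowerLegs.free`, `BlockAveragedKernelLegs.letter_free`∕`letterDiff_free`, `PerfectPropagatorLegDataFree.free_diff2∕3_le`, `free.err4`,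
# `free_diff1_sub_d1_le`, `free_diff2_sub_hess_le`) DISCHARGE every leg hypothesis of `PolarizationGerm.abs_bubble_sub_leadGermSc_le`, so that for EVERY
# scalar cubic family `v` (bi-localised, translation covariant, total zero mass) and `4 ≤ ‖z‖∞`:
# `|bubble G0ker (v μ 0) (v ν z) − leadGermSc c₄ (cubicGermOfSc v) μ ν (toReal z)| ≤ Cbub 1 Cs δ A₀ᴳ A₁ᴳ A₂ᴳ A₃ᴳ D₀ᴳ D₁ᴳ D₂ᴳ ∕ ‖z‖∞⁷` (constants DISPLAYED)

HONEST DEPENDENCY (page 1, mandatory): continuum YM on T⁴ ⇐ BetaPertH ∧ nine spine estimates (0/9 proved); BetaPertH ⇐ (D1) ∧ (D4) ∧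
CAP+tail; G-an2-4 gates asym, D1 and NE2/3/4.  HONEST FRAMING (cell contract, verbatim): «discharging `BetaPertH` makes Bałaban's UV
stability UNCONDITIONAL — a real constructive-QFT result; it is NOT the continuum limit and NOT the Clay problem.»  THIS MODULE is wiring BY NAME of tree
theorems (gan24-formalise-leaf-02-g39's ghost END `abs_bubble_sub_leadGermSc_le`; the free-leg letters above, which rest on lit1's kernel-checked lattice Green's
function asymptotics; the H2V-0 object `G0ker` with `G0ker_translate`).  The only remaining hypotheses are the VERTEX letters of the scalar family (for the road:
`v = ghCur`, whose germ `cubicGermOfSc ghCur = ghostGerm` is H2V-3 ✓ — not used here).  No `def`, no `def … : Prop`, nothing cited, 0 sorry.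
WHAT IT IS: a statement about an EXPLICIT object (half the lattice Green's function on `ℤ⁴` as the ghost leg).  WHAT IT IS NOT: not the gluon sector (module A
`PolarizationGermPker` ✓ p247056), not the colour step nor `hgerm` (module C); 0∕4 row-D1 binders; NOT hgerm, NOT D1, NOT BetaPertH, NOT continuum, NOT Clay.

ABSOLUTE RULE (cell charter, verbatim): «No internally-minted statement may enter as a cited fact. Every hypothesis is either kernel-proved in this
package or a verbatim quotation of a PUBLISHED theorem with page reference. The manuscript(s) under audit are NOT citable for their own disputed
steps — they are the thing under adjudication; programme-internal (2001/route/tribunal) claims are never citable.»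

CONTENT.
* §1 [folklore] both orientations of `G0ker`'s entry as the function `w ↦ latticeGreen w ∕ 2` (`latticeGreen_neg`), and the third `fwdDiff` unfolding to the
  8-point combination of `free_diff3_le` (first∕second unfoldings BY NAME from module A `PolarizationGermPker`).
* §2 [our object] `graded_G0ker` — (L0)–(L3) for `w ↦ latticeGreen w∕2` in the END's shape with `A₀ᴳ = 4(U₀+c₄+B₀)`, `A₁ᴳ = 8(2U₀+2c₄+Bgrad₀)`,
  `A₂ᴳ = 2⁴(64B₃+89098c₄) + 5⁴·4U₀`, `A₃ᴳ = 2⁵(128B₃+701568c₄) + 7⁵·8U₀`; `dict_G0ker` — (D0)–(D2) on `4 ≤ ‖t‖∞` with `cG = c₄`, `D₀ᴳ = B₀`, `D₁ᴳ = B₃+112c₄`,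
  `D₂ᴳ = 64B₃+89088c₄` (`U₀, B₀ = free.U, free.B`; `B₃ = B3free`).
* §3 [our object] **`abs_bubble_G0ker_sub_leadGermSc_le`** — THE GHOST-SECTOR END AT `G0ker`.
Provenance: road FP OWNER b2b-balaban-beta-d1-p3 gen 8 (prover-b2b-balaban-beta-d1-p3-g8-0), 2026-08-21, row H2-ASM-5 module B; «not in print; our bookkeeping».
-/

noncomputable section

namespace Summit.QuantumFields.BalabanUV.Beta.FP.PolarizationGermGhost

open Finset fwdDiff
open scoped BigOperators
open Literature.Probability.LatticeModels (latticeGreen latticeGreen_neg)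
open Literature.MathematicalPhysics.QuantumFieldTheory.Balaban1983to89
open Literature.MathematicalPhysics.QuantumFieldTheory.Balaban1983to89.Beta
open Literature.MathematicalPhysics.QuantumFieldTheory.Balaban1983to89.Beta.TransverseStructure
open Literature.MathematicalPhysics.QuantumFieldTheory.Balaban1983to89.Beta.BubbleTransfer
open Literature.MathematicalPhysics.QuantumFieldTheory.Balaban1983to89.Beta.TwoPowerLegs (TwoPower free free_g)
open ExpKernelCalculus (Site MKer BiLoc bubble shiftK)
open DyadicShell (Pt supNorm toReal supNorm_pos supNorm_eq_zero_iff)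
open Summit.QuantumFields.BalabanUV.Beta.FP.MarginalUniqueness (Idx)
open Summit.QuantumFields.BalabanUV.Beta.FP.GhostCubicGerm (cubicGermOfSc)
open Summit.QuantumFields.BalabanUV.Beta.FP.PolarizationGermBubble (leadGermSc)
open Summit.QuantumFields.BalabanUV.Beta.FP.PolarizationGermLegs (Cbub)
open Summit.QuantumFields.BalabanUV.Beta.FP.PolarizationGerm (abs_bubble_sub_leadGermSc_le)
open Summit.QuantumFields.BalabanUV.Beta.FP.PolarizationGermPker (fwdDiff_apply' fwdDiff₂_apply')
open Summit.QuantumFields.BalabanUV.Beta.FP.PerfectPolarization (G0ker G0ker_apply G0ker_translate)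
open Summit.QuantumFields.BalabanUV.Beta.FP.PerfectPropagatorLegDataFree (B3free free_diff2_le free_diff3_le free_diff1_sub_d1_le free_diff2_sub_hess_le)
open Summit.QuantumFields.BalabanUV.Beta.FP.BlockAveragedKernelLegs (letter_free letterDiff_free)

/-! ## §1 Orientation and difference bookkeeping -/

/-- [our object] the reflected orientation of the ghost leg IS `w ↦ latticeGreen w ∕ 2` (`latticeGreen` is even). -/
theorem G0ker_bwd_eq : (fun w : Pt => G0ker 0 (-w) () ()) = fun w => latticeGreen w / 2 := by
  funext w
  rw [G0ker_apply, sub_zero, latticeGreen_neg]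

/-- [our object] the forward orientation of the ghost leg IS `w ↦ latticeGreen w ∕ 2`. -/
theorem G0ker_fwd_eq : (fun w : Pt => G0ker 0 w () ()) = fun w => latticeGreen w / 2 := by
  funext w
  rw [G0ker_apply, sub_zero]

/-- [our object] the reflected entry. -/
theorem G0ker_bwd_apply (t : Pt) : G0ker 0 (-t) () () = latticeGreen t / 2 := by
  rw [G0ker_apply, sub_zero, latticeGreen_neg]

/-- [our object] the forward entry. -/
theorem G0ker_fwd_apply (t : Pt) : G0ker 0 t () () = latticeGreen t / 2 := by
  rw [G0ker_apply, sub_zero]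

/-- [folklore] third forward difference, unfolded to the eight-point combination (the shape of `free_diff3_le`). -/
theorem fwdDiff₃_eq (f : Pt → ℝ) (h k l t : Pt) :
    Δ_[h] (Δ_[k] (Δ_[l] f)) t
      = f (t + h + k + l) - f (t + h + k) - f (t + h + l) - f (t + k + l) + f (t + h) + f (t + k) + f (t + l) - f t := by
  simp only [fwdDiff]
  have a1 : t + h + l = t + l + h := by abel
  have a2 : t + k + l = t + l + k := by abel
  have a3 : t + h + k + l = t + l + h + k := by abel
  rw [a1, a2, a3]
  ring_nf

/-! ## §2 The free-leg letters in the END's shapes -/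

/-- [our object] **(L0)–(L3) FOR THE GHOST LEG** `w ↦ latticeGreen w ∕ 2`, every `t` (lit1's lattice Green's function asymptotics through the tree's packaged letters). -/
theorem graded_free (t : Pt) :
    |latticeGreen t / 2| ≤ (4 * (free.U + c4 + free.B)) / ((supNorm t : ℝ) + 1) ^ 2
      ∧ (∀ i, |Δ_[(Pi.single i 1 : Pt)] (fun w => latticeGreen w / 2) t| ≤ (8 * (2 * free.U + 2 * c4 + free.Bgrad)) / ((supNorm t : ℝ) + 1) ^ 3)
      ∧ (∀ i j, |Δ_[(Pi.single i 1 : Pt)] (Δ_[(Pi.single j 1 : Pt)] (fun w => latticeGreen w / 2)) t|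
          ≤ (2 ^ 4 * (64 * B3free + 89098 * c4) + ((4 : ℕ) + 1 : ℝ) ^ 4 * (4 * free.U)) / ((supNorm t : ℝ) + 1) ^ 4)
      ∧ (∀ i j l, |Δ_[(Pi.single i 1 : Pt)] (Δ_[(Pi.single j 1 : Pt)] (Δ_[(Pi.single l 1 : Pt)] (fun w => latticeGreen w / 2))) t|
          ≤ (2 ^ 5 * (128 * B3free + 701568 * c4) + ((6 : ℕ) + 1 : ℝ) ^ 5 * (8 * free.U)) / ((supNorm t : ℝ) + 1) ^ 5) := by
  refine ⟨letter_free t, fun i => ?_, fun i j => ?_, fun i j l => ?_⟩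
  · rw [fwdDiff_apply']
    exact letterDiff_free i t
  · rw [fwdDiff₂_apply']
    simpa [unitVec] using free_diff2_le i j t
  · rw [fwdDiff₃_eq]
    simpa [unitVec] using free_diff3_le i j l t

/-- [our object] **(D0)–(D2) FOR THE GHOST LEG** on `4 ≤ ‖t‖∞`, `cG = c₄` (the value letter at order `‖t‖⁻⁴ ≤ ‖t‖⁻³`). -/
theorem dict_free (t : Pt) (ht : 4 ≤ supNorm t) :
    |latticeGreen t / 2 - c4 * invSq (toReal t)| ≤ free.B / (supNorm t : ℝ) ^ 3
      ∧ (∀ i, |Δ_[(Pi.single i 1 : Pt)] (fun w => latticeGreen w / 2) t - c4 * d1InvSq i (toReal t)| ≤ (B3free + 112 * c4) / (supNorm t : ℝ) ^ 4)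
      ∧ (∀ i j, |Δ_[(Pi.single i 1 : Pt)] (Δ_[(Pi.single j 1 : Pt)] (fun w => latticeGreen w / 2)) t - c4 * hessInvSq i j (toReal t)|
          ≤ (64 * B3free + 89088 * c4) / (supNorm t : ℝ) ^ 5) := by
  have ht0 : t ≠ 0 := by
    intro h; rw [h] at ht; rw [supNorm_eq_zero_iff.mpr rfl] at ht; omega
  have ht2 : 2 ≤ supNorm t := le_trans (by norm_num) ht
  have hs1 : (1 : ℝ) ≤ supNorm t := by exact_mod_cast le_trans (by norm_num : 1 ≤ 4) ht
  refine ⟨?_, fun i => ?_, fun i j => ?_⟩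
  · have h := free.err4 0 0 t ht0
    rw [free_g] at h
    refine h.trans ?_
    exact div_le_div_of_nonneg_left free.nonneg_B (by positivity) (pow_le_pow_right₀ hs1 (by norm_num))
  · rw [fwdDiff_apply']
    simpa [unitVec] using free_diff1_sub_d1_le i ht2
  · rw [fwdDiff₂_apply']
    simpa [unitVec] using free_diff2_sub_hess_le i j ht

/-! ## §3 The ghost-sector END at `G0ker` -/

section End

variable {v : Fin 4 → Site 4 → MKer 4 Unit} {Cs δ : ℝ}

/-- **THE GHOST-SECTOR END OF H2-ASM-3 AT THE EXPLICIT GHOST LEG** [our object] (row H2-ASM-5, module B): for EVERY scalar cubic family `v`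
(bi-localised at the background point, translation covariant, total zero mass) and every `z` with `4 ≤ ‖z‖∞`:
`|bubble G0ker (v μ 0) (v ν z) − leadGermSc c₄ (cubicGermOfSc v) μ ν (toReal z)| ≤ Cbub 1 Cs δ A₀ᴳ A₁ᴳ A₂ᴳ A₃ᴳ B₀ D₁ᴳ D₂ᴳ ∕ ‖z‖∞⁷`
with the free-leg constants displayed in §2 — `PolarizationGerm.abs_bubble_sub_leadGermSc_le` BY NAME at `A := G0ker`, `cG := c₄`, `R₀ := 4`. -/
theorem abs_bubble_G0ker_sub_leadGermSc_le (hδ : 0 < δ)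
    (hv : ∀ (lam : Fin 4) (u : Site 4), BiLoc (v lam u) u u Cs δ)
    (hcov : ∀ (lam : Fin 4) (w : Site 4), v lam w = shiftK (-w) (v lam 0))
    (h0 : ∀ lam : Fin 4, ∑' p : Pt × Pt, v lam 0 p.1 p.2 () () = 0)
    (μ ν : Fin 4) {z : Pt} (hz : 4 ≤ supNorm z) :
    |bubble G0ker (v μ 0) (v ν z) - leadGermSc c4 (cubicGermOfSc v) μ ν (toReal z)|
      ≤ Cbub 1 Cs δ (4 * (free.U + c4 + free.B)) (8 * (2 * free.U + 2 * c4 + free.Bgrad))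
          (2 ^ 4 * (64 * B3free + 89098 * c4) + ((4 : ℕ) + 1 : ℝ) ^ 4 * (4 * free.U))
          (2 ^ 5 * (128 * B3free + 701568 * c4) + ((6 : ℕ) + 1 : ℝ) ^ 5 * (8 * free.U))
          free.B (B3free + 112 * c4) (64 * B3free + 89088 * c4) / (supNorm z : ℝ) ^ 7 := by
  have hA : ∀ x y (a b : Unit), |G0ker x y a b| ≤ free.U := by
    intro x y a b
    rw [G0ker_apply]
    have h := free.bdd 0 0 (y - x)
    rwa [free_g] at h
  have hF : ∀ t : Pt, |G0ker 0 (-t) () ()| ≤ (4 * (free.U + c4 + free.B)) / ((supNorm t : ℝ) + 1) ^ 2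
      ∧ (∀ i, |Δ_[(Pi.single i 1 : Pt)] (fun w => G0ker 0 (-w) () ()) t| ≤ (8 * (2 * free.U + 2 * c4 + free.Bgrad)) / ((supNorm t : ℝ) + 1) ^ 3)
      ∧ (∀ i j, |Δ_[(Pi.single i 1 : Pt)] (Δ_[(Pi.single j 1 : Pt)] (fun w => G0ker 0 (-w) () ())) t|
          ≤ (2 ^ 4 * (64 * B3free + 89098 * c4) + ((4 : ℕ) + 1 : ℝ) ^ 4 * (4 * free.U)) / ((supNorm t : ℝ) + 1) ^ 4)
      ∧ (∀ i j l, |Δ_[(Pi.single i 1 : Pt)] (Δ_[(Pi.single j 1 : Pt)] (Δ_[(Pi.single l 1 : Pt)] (fun w => G0ker 0 (-w) () ()))) t|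
          ≤ (2 ^ 5 * (128 * B3free + 701568 * c4) + ((6 : ℕ) + 1 : ℝ) ^ 5 * (8 * free.U)) / ((supNorm t : ℝ) + 1) ^ 5) := by
    intro t
    rw [G0ker_bwd_apply, G0ker_bwd_eq]
    exact graded_free t
  have hG : ∀ t : Pt, |G0ker 0 t () ()| ≤ (4 * (free.U + c4 + free.B)) / ((supNorm t : ℝ) + 1) ^ 2
      ∧ (∀ i, |Δ_[(Pi.single i 1 : Pt)] (fun w => G0ker 0 w () ()) t| ≤ (8 * (2 * free.U + 2 * c4 + free.Bgrad)) / ((supNorm t : ℝ) + 1) ^ 3)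
      ∧ (∀ i j, |Δ_[(Pi.single i 1 : Pt)] (Δ_[(Pi.single j 1 : Pt)] (fun w => G0ker 0 w () ())) t|
          ≤ (2 ^ 4 * (64 * B3free + 89098 * c4) + ((4 : ℕ) + 1 : ℝ) ^ 4 * (4 * free.U)) / ((supNorm t : ℝ) + 1) ^ 4)
      ∧ (∀ i j l, |Δ_[(Pi.single i 1 : Pt)] (Δ_[(Pi.single j 1 : Pt)] (Δ_[(Pi.single l 1 : Pt)] (fun w => G0ker 0 w () ()))) t|
          ≤ (2 ^ 5 * (128 * B3free + 701568 * c4) + ((6 : ℕ) + 1 : ℝ) ^ 5 * (8 * free.U)) / ((supNorm t : ℝ) + 1) ^ 5) := by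
    intro t
    rw [G0ker_fwd_apply, G0ker_fwd_eq]
    exact graded_free t
  have hDF : ∀ t : Pt, 4 ≤ supNorm t →
      |G0ker 0 (-t) () () - c4 * invSq (toReal t)| ≤ free.B / (supNorm t : ℝ) ^ 3
      ∧ (∀ i, |Δ_[(Pi.single i 1 : Pt)] (fun w => G0ker 0 (-w) () ()) t - c4 * d1InvSq i (toReal t)| ≤ (B3free + 112 * c4) / (supNorm t : ℝ) ^ 4)
      ∧ (∀ i j, |Δ_[(Pi.single i 1 : Pt)] (Δ_[(Pi.single j 1 : Pt)] (fun w => G0ker 0 (-w) () ())) t - c4 * hessInvSq i j (toReal t)|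
          ≤ (64 * B3free + 89088 * c4) / (supNorm t : ℝ) ^ 5) := by
    intro t ht
    rw [G0ker_bwd_apply, G0ker_bwd_eq]
    exact dict_free t ht
  have hDG : ∀ t : Pt, 4 ≤ supNorm t →
      |G0ker 0 t () () - c4 * invSq (toReal t)| ≤ free.B / (supNorm t : ℝ) ^ 3
      ∧ (∀ i, |Δ_[(Pi.single i 1 : Pt)] (fun w => G0ker 0 w () ()) t - c4 * d1InvSq i (toReal t)| ≤ (B3free + 112 * c4) / (supNorm t : ℝ) ^ 4)
      ∧ (∀ i j, |Δ_[(Pi.single i 1 : Pt)] (Δ_[(Pi.single j 1 : Pt)] (fun w => G0ker 0 w () ())) t - c4 * hessInvSq i j (toReal t)|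
          ≤ (64 * B3free + 89088 * c4) / (supNorm t : ℝ) ^ 5) := by
    intro t ht
    rw [G0ker_fwd_apply, G0ker_fwd_eq]
    exact dict_free t ht
  exact abs_bubble_sub_leadGermSc_le (A := G0ker) (cG := c4) (R₀ := 4) hδ hA G0ker_translate hF hG (by norm_num) hDF hDG hv hcov h0 μ ν hz

end End

end Summit.QuantumFields.BalabanUV.Beta.FP.PolarizationGermGhost

end
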